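import Mathlib
import Literature.Topology.FourManifolds.PlanarAchiralWords
import Literature.Topology.FourManifolds.PlanarShadowWalk
import Summits.SmoothPoincare4.SmoothPoincare4.Theorems.ConvexBisectionPlanarAcyclicBisectionRigidityHelperWalkThreeGeneric
import Summits.SmoothPoincare4.SmoothPoincare4.Theorems.ConvexBisectionPlanarAcyclicBisectionRigidityHelperUnimodularTransfer
import HarnessLib

/-!
# Crux `ConvexBisection.PlanarAcyclicBisectionRigidity`, line Sketch v3.0 — `stub_walk3`, part 3a:
# classification of letters and the configurations of a unimodular block on three holes

Combinatorics of the planar word calculus on three holes (nothing topological).  Every in-range letter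
is CENTRAL (single-hole or three-hole: its positive twist is a hole twist or the outer twist) or of
kind `x` / `y` / `z` (two-hole, hole types `110` / `011` / `101`; `twoHoleTwist_normalForm3`,
p147003).  Hole types pin the kind and, for central letters, the twist itself; unimodularity of a
block forces pairwise distinct hole types and excludes the configuration `{x, y, z}`; three letters
with three distinct type values can be arranged along any list of the values.  Registered helper:
`helper_walk3_classify`.  Parts 3b/3c: the degenerate configurations, global conjugations, and the
assembly `Walk3.walk3_of_helpers`.
-/

noncomputable section

open Literature.Topology.FourManifolds Literature.Topology.FourManifolds.PlanarWords
open Literature.Topology.FourManifolds.PlanarShadow (F₂ gx gy IsXYGen shadowWord shadowWord_append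
  shadowWord_nil XYPairs)

-- the prescribed namespace `Summit.<S>.<P>.…` repeats `SmoothPoincare4` (S = P = SmoothPoincare4)
set_option linter.dupNamespace false

namespace Summit.SmoothPoincare4.SmoothPoincare4.Theorems.PlanarAcyclicBisectionRigidity.Sketch

namespace Walk3

open ArcData PGen WalkLow SeamNG ReachMon Conj3

set_option quotPrecheck false in
/-- `Central[d]`: the positive twist of `d` is `T_[j,j]` for some `j` or `T_[0,2]`. [folklore] -/
local notation "Central[" d "]" => ((∃ j : Fin 3, T 3 (d, true) = U 3 [PGen.round j.val j.val false]) ∨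
  T 3 (d, true) = U 3 [PGen.round 0 2 false])

set_option quotPrecheck false in
/-- `XYData[c, p]`: the positive twist of `c` evaluates like an XY-word of shadow `p`. [folklore] -/
local notation "XYData[" c ", " p "]" => (∃ g : List PGen, (∀ q ∈ g, IsXYGen q) ∧ shadowWord g = p ∧
  evalWord 3 (PlanarCurve.twistWord c true) = evalWord 3 g)

set_option quotPrecheck false in
/-- `KindX[c]`: `c` has hole type `110` and `x`-data. [folklore] -/
local notation "KindX[" c "]" => (AbArc.typeVec 3 c = ![1, 1, 0] ∧
  ∃ p : F₂, XYData[c, p] ∧ ∃ u : F₂, p = u * gx * u⁻¹)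

set_option quotPrecheck false in
/-- `KindY[c]`: `c` has hole type `011` and `y`-data. [folklore] -/
local notation "KindY[" c "]" => (AbArc.typeVec 3 c = ![0, 1, 1] ∧
  ∃ p : F₂, XYData[c, p] ∧ ∃ u : F₂, p = u * gy * u⁻¹)

set_option quotPrecheck false in
/-- `KindZ[c]`: `c` has hole type `101`. [folklore] -/
local notation "KindZ[" c "]" => (AbArc.typeVec 3 c = ![1, 0, 1])

/-! ## Classification of an in-range letter -/

/-- The shape `⟨j, j, []⟩` has positive twist `T_[j,j]` (definitional). [folklore] -/
theorem T_shape_single (j : Fin 3) : T 3 ((⟨j.val, j.val, []⟩ : PlanarCurve), true) = U 3 [round j.val j.val false] :=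
  rfl

/-- The shape `⟨0, 2, []⟩` has positive twist `T_[0,2]` (definitional). [folklore] -/
theorem T_shape_outer : T 3 ((⟨0, 2, []⟩ : PlanarCurve), true) = U 3 [round 0 2 false] := rfl

/-- **The hole type of a central letter**: a unit vector (hole twist) or `111` (outer twist).
[folklore] -/
theorem typeVec_central {c : PlanarCurve} (hc : c.InRange 3) (h : Central[c]) :
    (∃ j : Fin 3, T 3 (c, true) = U 3 [round j.val j.val false] ∧ AbArc.typeVec 3 c = Pi.single j (1 : ℤ)) ∨
      (T 3 (c, true) = U 3 [round 0 2 false] ∧ AbArc.typeVec 3 c = ![1, 1, 1]) := by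
  rcases h with ⟨j, hj⟩ | hj
  · refine Or.inl ⟨j, hj, ?_⟩
    rw [← typeVec_single j]
    exact typeVec_eq_of_twist_eq3 hc (congrArg Units.val (hj.trans (T_shape_single j).symm))
  · refine Or.inr ⟨hj, ?_⟩
    rw [← typeVec_outer]
    exact typeVec_eq_of_twist_eq3 hc (congrArg Units.val (hj.trans T_shape_outer.symm))

/-- **CLASSIFICATION.**  Every in-range letter on three holes is central, or of kind `x`, `y` or `z`.
By cases on its round block `[a, b]` (`a = b`: hole twist, `Walk3.T_central_single`; `(0,2)`: outer
twist; `b = a + 1`: `twoHoleTwist_normalForm3` and the types of the three shapes). [folklore] -/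
theorem classify {c : PlanarCurve} (hc : c.InRange 3) :
    Central[c] ∨ KindX[c] ∨ KindY[c] ∨ KindZ[c] := by
  obtain ⟨hab, hb, hg⟩ := hc
  rcases Nat.lt_or_ge c.a c.b with hlt | hge
  · rcases Nat.lt_or_ge (c.a + 1) c.b with hlt2 | hge2
    · -- three holes: `(a, b) = (0, 2)`
      have h0 : c.a = 0 := by omega
      have h2 : c.b = 2 := by omega
      exact Or.inl (Or.inr (T_central_outer ⟨hab, hb, hg⟩ h0 h2))
    · -- two holes
      have h2 : c.b = c.a + 1 := by omega
      obtain ⟨h, hh, hcase⟩ := twoHoleTwist_normalForm3 c ⟨hab, hb, hg⟩ h2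
      have hbelow : ∀ q ∈ h, q.below 3 = true := fun q hq => below_of_xy (hh q hq)
      rcases hcase with h01 | h12 | hz
      · refine Or.inr (Or.inl ⟨?_, shadowWord h * gx * (shadowWord h)⁻¹, ⟨_, (kind01 hh).1,
          (kind01 hh).2, h01⟩, shadowWord h, rfl⟩)
        rw [← typeVec01 hh]
        exact typeVec_eq_of_twist_eq3 ⟨hab, hb, hg⟩ h01
      · refine Or.inr (Or.inr (Or.inl ⟨?_, shadowWord h * gy * (shadowWord h)⁻¹, ⟨_, (kind12 hh).1,
          (kind12 hh).2, h12⟩, shadowWord h, rfl⟩))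
        rw [← typeVec12 hh]
        exact typeVec_eq_of_twist_eq3 ⟨hab, hb, hg⟩ h12
      · refine Or.inr (Or.inr (Or.inr ?_))
        rw [← typeVecZ hh]
        exact typeVec_eq_of_twist_eq3 ⟨hab, hb, hg⟩ hz
  · -- one hole
    exact Or.inl (Or.inl (T_central_single ⟨hab, hb, hg⟩ (le_antisymm hab hge)))

/-! ## Hole types pin kinds and central twists -/

/-- Central letters have hole types of coordinate sum `1` or `3`. [folklore] -/
theorem typeSum_central {c : PlanarCurve} (hc : c.InRange 3) (h : Central[c]) :
    AbArc.typeVec 3 c 0 + AbArc.typeVec 3 c 1 + AbArc.typeVec 3 c 2 = 1 ∨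
      AbArc.typeVec 3 c 0 + AbArc.typeVec 3 c 1 + AbArc.typeVec 3 c 2 = 3 := by
  rcases typeVec_central hc h with ⟨j, -, hj⟩ | ⟨-, hj⟩
  · left; rw [hj]; fin_cases j <;> simp
  · right; rw [hj]; simp

/-- Two-hole kinds have hole types of coordinate sum `2`; so a letter whose type is a two-hole type
is not central, and conversely. [folklore] -/
theorem not_central_of_type {c : PlanarCurve} (hc : c.InRange 3)
    (ht : AbArc.typeVec 3 c = ![1, 1, 0] ∨ AbArc.typeVec 3 c = ![0, 1, 1] ∨ AbArc.typeVec 3 c = ![1, 0, 1]) :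
    ¬ Central[c] := by
  intro h
  rcases typeSum_central hc h with hs | hs <;> rcases ht with ht | ht | ht <;> rw [ht] at hs <;>
    simp at hs

/-- **Equal hole types, equal central twists.** [folklore] -/
theorem central_twist_eq_of_type_eq {c d : PlanarCurve} (hc : c.InRange 3) (hd : d.InRange 3)
    (h₁ : Central[c]) (h₂ : Central[d]) (ht : AbArc.typeVec 3 c = AbArc.typeVec 3 d) :
    T 3 (c, true) = T 3 (d, true) := by
  rcases typeVec_central hc h₁ with ⟨j, hj, hjt⟩ | ⟨hj, hjt⟩ <;>
    rcases typeVec_central hd h₂ with ⟨k, hk, hkt⟩ | ⟨hk, hkt⟩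
  · have hjk : j = k := by
      have := congrFun (hjt.symm.trans (ht.trans hkt)) j
      simp only [Pi.single_eq_same] at this
      by_contra hne
      rw [Pi.single_eq_of_ne hne] at this
      exact one_ne_zero this
    subst hjk; exact hj.trans hk.symm
  · exfalso
    have := congrFun (hjt.symm.trans (ht.trans hkt))
    have h0 := this 0; have h1 := this 1
    fin_cases j <;> simp at h0 h1
  · exfalso
    have := congrFun (hkt.symm.trans (ht.symm.trans hjt))
    have h0 := this 0; have h1 := this 1
    fin_cases k <;> simp at h0 h1
  · exact hj.trans hk.symm

/-- A letter with the type of an `x`-letter is an `x`-letter (classification + type sums). [folklore] -/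
theorem kindX_of_type {c : PlanarCurve} (hc : c.InRange 3) (ht : AbArc.typeVec 3 c = ![1, 1, 0]) :
    KindX[c] := by
  rcases classify hc with h | h | h | h
  · exact absurd h (not_central_of_type hc (Or.inl ht))
  · exact h
  · exfalso; have := congrFun (h.1.symm.trans ht) 0; simp at this
  · exfalso; have := congrFun (h.symm.trans ht) 1; simp at this

/-- A letter with the type of a `y`-letter is a `y`-letter. [folklore] -/
theorem kindY_of_type {c : PlanarCurve} (hc : c.InRange 3) (ht : AbArc.typeVec 3 c = ![0, 1, 1]) :
    KindY[c] := by
  rcases classify hc with h | h | h | h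
  · exact absurd h (not_central_of_type hc (Or.inr (Or.inl ht)))
  · exfalso; have := congrFun (h.1.symm.trans ht) 0; simp at this
  · exact h
  · exfalso; have := congrFun (h.symm.trans ht) 1; simp at this

/-- A letter with a central type is central. [folklore] -/
theorem central_of_type {c d : PlanarCurve} (hc : c.InRange 3) (hd : d.InRange 3) (hdc : Central[d])
    (ht : AbArc.typeVec 3 c = AbArc.typeVec 3 d) : Central[c] := by
  rcases classify hc with h | h | h | h
  · exact h
  all_goals exfalso
  · exact not_central_of_type hd (Or.inl (ht ▸ h.1)) hdc
  · exact not_central_of_type hd (Or.inr (Or.inl (ht ▸ h.1))) hdc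
  · exact not_central_of_type hd (Or.inr (Or.inr (ht ▸ h))) hdc

/-! ## Unimodular blocks: distinct types, at most two two-hole letters -/

/-- The rows of a unimodular three-letter block form an invertible integer matrix. [folklore] -/
theorem isUnit_det_of_unimodular {a b c : PlanarCurve} (hu : Unimodular 3 [a, b, c]) :
    IsUnit (Matrix.det ![AbArc.typeVec 3 a, AbArc.typeVec 3 b, AbArc.typeVec 3 c]) := by
  have h := (UniTransfer.span_eq_top_iff_isUnit_det ([a, b, c].map (AbArc.typeVec 3)) (by simp)).1
    (UniTransfer.span_typeVec_eq_top_of_unimodular [a, b, c] hu)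
  convert h using 2
  ext k i
  fin_cases k <;> rfl

/-- **Distinct types**: two letters of a unimodular three-letter block have different hole types
(equal rows kill the determinant). [folklore] -/
theorem types_ne_of_unimodular {a b c : PlanarCurve} (hu : Unimodular 3 [a, b, c]) :
    AbArc.typeVec 3 a ≠ AbArc.typeVec 3 b ∧ AbArc.typeVec 3 a ≠ AbArc.typeVec 3 c ∧
      AbArc.typeVec 3 b ≠ AbArc.typeVec 3 c := by
  have h := isUnit_det_of_unimodular hu
  refine ⟨fun e => ?_, fun e => ?_, fun e => ?_⟩
  · rw [Matrix.det_zero_of_row_eq (i := 0) (j := 1) (by decide) (by simp [e])] at h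
    exact not_isUnit_zero h
  · rw [Matrix.det_zero_of_row_eq (i := 0) (j := 2) (by decide) (by simp [e])] at h
    exact not_isUnit_zero h
  · rw [Matrix.det_zero_of_row_eq (i := 1) (j := 2) (by decide) (by simp [e])] at h
    exact not_isUnit_zero h

/-- **At most two two-hole letters**: the three two-hole types `110, 011, 101` do not span `ℤ³`
(their determinant is `±2`). [folklore] -/
theorem not_xyz_of_unimodular {a b c : PlanarCurve} (hu : Unimodular 3 [a, b, c])
    (ha : AbArc.typeVec 3 a = ![1, 1, 0] ∨ AbArc.typeVec 3 a = ![0, 1, 1] ∨ AbArc.typeVec 3 a = ![1, 0, 1])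
    (hb : AbArc.typeVec 3 b = ![1, 1, 0] ∨ AbArc.typeVec 3 b = ![0, 1, 1] ∨ AbArc.typeVec 3 b = ![1, 0, 1])
    (hc : AbArc.typeVec 3 c = ![1, 1, 0] ∨ AbArc.typeVec 3 c = ![0, 1, 1] ∨ AbArc.typeVec 3 c = ![1, 0, 1]) :
    False := by
  have h := isUnit_det_of_unimodular hu
  rw [Int.isUnit_iff] at h
  rcases ha with ha | ha | ha <;> rcases hb with hb | hb | hb <;> rcases hc with hc | hc | hc <;>
    rw [ha, hb, hc] at h <;> revert h <;> simp [Matrix.det_fin_three]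

/-! ## Arranging three letters by three distinct type values -/

/-- **Arrangement by types.**  If the hole types of `f₁, f₂, f₃` are a permutation of three pairwise
distinct values `T₁, T₂, T₃`, the letters can be named `g₁, g₂, g₃` with these types, `[f₁, f₂, f₃]`
being one of the six arrangements of `(g₁, g₂, g₃)`. [folklore] -/
theorem arrange3 (f₁ f₂ f₃ : PlanarCurve) (T₁ T₂ T₃ : Fin 3 → ℤ) (h12 : T₁ ≠ T₂) (h13 : T₁ ≠ T₃)
    (h23 : T₂ ≠ T₃)
    (hp : List.Perm [T₁, T₂, T₃] [AbArc.typeVec 3 f₁, AbArc.typeVec 3 f₂, AbArc.typeVec 3 f₃]) :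
    ∃ g₁ g₂ g₃ : PlanarCurve, AbArc.typeVec 3 g₁ = T₁ ∧ AbArc.typeVec 3 g₂ = T₂ ∧ AbArc.typeVec 3 g₃ = T₃ ∧
      (g₁ ∈ [f₁, f₂, f₃] ∧ g₂ ∈ [f₁, f₂, f₃] ∧ g₃ ∈ [f₁, f₂, f₃]) ∧
      ([f₁, f₂, f₃] = [g₁, g₂, g₃] ∨ [f₁, f₂, f₃] = [g₁, g₃, g₂] ∨ [f₁, f₂, f₃] = [g₂, g₁, g₃] ∨
        [f₁, f₂, f₃] = [g₃, g₁, g₂] ∨ [f₁, f₂, f₃] = [g₂, g₃, g₁] ∨ [f₁, f₂, f₃] = [g₃, g₂, g₁]) := by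
  have m₁ : T₁ ∈ [AbArc.typeVec 3 f₁, AbArc.typeVec 3 f₂, AbArc.typeVec 3 f₃] := hp.subset (by simp)
  have m₂ : T₂ ∈ [AbArc.typeVec 3 f₁, AbArc.typeVec 3 f₂, AbArc.typeVec 3 f₃] := hp.subset (by simp)
  have m₃ : T₃ ∈ [AbArc.typeVec 3 f₁, AbArc.typeVec 3 f₂, AbArc.typeVec 3 f₃] := hp.subset (by simp)
  -- the target list has no duplicates either, so equal types means equal positions
  have hnd : [AbArc.typeVec 3 f₁, AbArc.typeVec 3 f₂, AbArc.typeVec 3 f₃].Nodup :=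
    hp.nodup_iff.1 (by simp [h12, h13, h23])
  have n12 : AbArc.typeVec 3 f₁ ≠ AbArc.typeVec 3 f₂ := by intro e; simp [e] at hnd
  have n13 : AbArc.typeVec 3 f₁ ≠ AbArc.typeVec 3 f₃ := by intro e; simp [e] at hnd
  have n23 : AbArc.typeVec 3 f₂ ≠ AbArc.typeVec 3 f₃ := by intro e; simp [e] at hnd
  have mem : f₁ ∈ [f₁, f₂, f₃] ∧ f₂ ∈ [f₁, f₂, f₃] ∧ f₃ ∈ [f₁, f₂, f₃] := by simp
  simp only [List.mem_cons, List.not_mem_nil, or_false] at m₁ m₂ m₃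
  rcases m₁ with h1 | h1 | h1 <;> rcases m₂ with h2 | h2 | h2 <;> rcases m₃ with h3 | h3 | h3
  -- 27 cases; the consistent ones are the 6 bijections
  all_goals first
    | exact absurd (h1.trans h2.symm) h12
    | exact absurd (h1.trans h3.symm) h13
    | exact absurd (h2.trans h3.symm) h23
    | skip
  · exact ⟨f₁, f₂, f₃, h1.symm, h2.symm, h3.symm, ⟨mem.1, mem.2.1, mem.2.2⟩, Or.inl rfl⟩
  · exact ⟨f₁, f₃, f₂, h1.symm, h2.symm, h3.symm, ⟨mem.1, mem.2.2, mem.2.1⟩, Or.inr (Or.inl rfl)⟩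
  · exact ⟨f₂, f₁, f₃, h1.symm, h2.symm, h3.symm, ⟨mem.2.1, mem.1, mem.2.2⟩, Or.inr (Or.inr (Or.inl rfl))⟩
  · exact ⟨f₂, f₃, f₁, h1.symm, h2.symm, h3.symm, ⟨mem.2.1, mem.2.2, mem.1⟩,
      Or.inr (Or.inr (Or.inr (Or.inl rfl)))⟩
  · exact ⟨f₃, f₁, f₂, h1.symm, h2.symm, h3.symm, ⟨mem.2.2, mem.1, mem.2.1⟩,
      Or.inr (Or.inr (Or.inr (Or.inr (Or.inl rfl))))⟩
  · exact ⟨f₃, f₂, f₁, h1.symm, h2.symm, h3.symm, ⟨mem.2.2, mem.2.1, mem.1⟩,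
      Or.inr (Or.inr (Or.inr (Or.inr (Or.inr rfl))))⟩

end Walk3

open ReachMon in
/-- **Registered helper `helper_walk3_classify`** (= `Walk3.classify`, notations expanded): an in-range
letter on three holes is central, of kind `x`, of kind `y`, or of kind `z`. [folklore] -/
theorem helper_walk3_classify (c : PlanarCurve) (hc : c.InRange 3) : ((∃ j : Fin 3, T 3 (c, true) = U 3 [PGen.round j.val j.val false]) ∨ T 3 (c, true) = U 3 [PGen.round 0 2 false]) ∨ (AbArc.typeVec 3 c = ![1, 1, 0] ∧ ∃ p : F₂, (∃ g : List PGen, (∀ q ∈ g, IsXYGen q) ∧ shadowWord g = p ∧ evalWord 3 (PlanarCurve.twistWord c true) = evalWord 3 g) ∧ ∃ u : F₂, p = u * gx * u⁻¹) ∨ (AbArc.typeVec 3 c = ![0, 1, 1] ∧ ∃ p : F₂, (∃ g : List PGen, (∀ q ∈ g, IsXYGen q) ∧ shadowWord g = p ∧ evalWord 3 (PlanarCurve.twistWord c true) = evalWord 3 g) ∧ ∃ u : F₂, p = u * gy * u⁻¹) ∨ AbArc.typeVec 3 c = ![1, 0, 1] :=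
  Walk3.classify hc

end Summit.SmoothPoincare4.SmoothPoincare4.Theorems.PlanarAcyclicBisectionRigidity.Sketch

end
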